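import Literature.MathematicalPhysics.QuantumFieldTheory.Balaban1983to89.B11

/-!
# `Balaban1983to89.B11Prop2Assembly` — T. Bałaban, *The variational problem and background fields in renormalization group method
# for lattice gauge theories*, Commun. Math. Phys. **102** (1985) 277–309 [Balaban1985Variational], **Proposition 2** (p. 281) ASSEMBLED
# from Theorem 2 of [6] = [Balaban1985RegularSpaces] (tree `B8.Thm2Printed`) BY NAME, through the located sentences of pp. 280–281

statement-level skeleton of published theorems with citation tags; proofs where landed; nothing here is a claim about the Yang–Mills mass gap

PDF held: `paper:balaban1985-cmp102-variational-background` (journal page = PDF page + 276); pp. 280–281 [PDF 4–5] read as images by this seat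
(renders `run/shared/lean/pub/pub-balaban/b2b-balaban-ref1/pages/1985-cmp102-variational-background/…-p004-x2.png`, `…-p005-x2.png`).

CITATION HEADER (lean-in-tree rule 2026-08-18).  WHAT IS REPRODUCED: SKELETON row `B11.Prop2` (reader r08 `ROWS-B11.md`; decl of record
`B11.Prop2Printed B₁ B₃ C₁ c₁ fam`, B11.lean, typed-existing over the Sect. A–E carrier `B11.LGData`; edge of record to [6] Thm 2:
`B11.p280_landau_gauge_of_B8Thm2` (the specialisation α₀ = ε₀, α₁ = C₁ε₁ of `B8.Thm2Printed` producing the gauge transformation u) and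
`B11.Claim280` row B11.Claim@280).  THIS FILE composes that edge with the remaining located sentences of p. 281 into the typed statement
of record.  THE PRINT (p. 281 [PDF 5], verbatim): *"Proposition 2. All critical orbits of the functional (5) in the space (6), or all
critical configurations of this functional in the space (18), can be obtained by taking critical configurations U₁ of the functional
A(U₁U₀) in the space defined by (19)–(21), where U₀ satisfies (14), and transforming them to the axial gauge Ax_k(𝔅_k, U₀) by gauge
transformations u satisfying the conditions \overline{R₀u}^j = 1 on Λ_j, 0, 1, …, k."*  ITS PRINTED PROOF (pp. 280–281, verbatim): *"Next we
apply the results of the paper [6], especially the Theorem 2. Configurations U from the space (18), and U₀, satisfy the assumptions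
(1.33)–(1.35) of this theorem with α₀ = ε₀, α₁ = C₁ε₁. The additional regularity condition (3.35) in (1.33) is satisfied for U₀ also,
because of the result of Sect. F. Thus for ε₀, ε₁ sufficiently small, more exactly for ε₀ + C₁ε₁ ≦ c₁, and for an arbitrary configuration
U = U′U₀ from (18) there exists exactly one gauge transformation u satisfying \overline{R₀u}^j = 1 on Λ_j, j = 0, 1, …, k (thus u = 1 on
Λ₀), such that U₁ = U′^{u^{−1}} satisfies the conditions (1.36)–(1.39) of [6]. These gauge transformations define a mapping of the space (18)
into a space of gauge field configurations U₁U₀ with U₁ satisfying the conditions [(19), (20), (21)] with ε₂ ≧ B₁(ε₀ + C₁ε₁). … The above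
mapping is one-to-one, hence using again the gauge invariance of the functional (5), we have reduced a proof of the existence and the
uniqueness of critical configurations in the space (18), to a proof of the existence and the uniqueness in the space of configurations U₁U₀
satisfying (19)–(21)."*

WHAT IS CERTIFIED (kernel, sorry-free; axioms `propext` / `Classical.choice` / `Quot.sound`).
§1 `Bridge62`, `Bridge62.Laws`: the dictionary between [6]'s Theorem-2 carrier `B8.GFData` (backgrounds, perturbations U′, gauge
   transformations u, the act U′ ↦ U′^{u⁻¹} = `act`, the conditions (1.33)–(1.39)) and the Sect. A–E carrier `B11.LGData`, with the four
   located sentences above as laws: `hyp133` («satisfy the assumptions (1.33)–(1.35) … with α₀ = ε₀, α₁ = C₁ε₁ … (3.35) … because of the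
   result of Sect. F»), `to19_21` («U₁ satisfying the conditions (19)–(21) with ε₂ ≧ B₁(ε₀ + C₁ε₁)» from (1.36)–(1.39)), `restricted`,
   `axial_back` ((16): u transforms U₁ = U′^{u⁻¹} back to U′), `crit` («using again the gauge invariance of the functional (5)»).
§2 **`prop2Printed_of_thm2`**: `B8.Thm2Printed famG` ⇒ `∃ B₁ c₁ > 0, B11.Prop2Printed B₁ B₃ C₁ c₁ famD` for every bridged family — with
   [6]'s own constants B₁, c₁ — and `prop2Printed_of_thm2_at` (the same at GIVEN Thm-2 constants, for consumers that fix B₁ = 5dLB₀).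

HONEST SCOPE — what is NOT claimed.  Theorem 2 of [6] is the INPUT (row B8.Thm2 typed-existing); the laws are located readings of printed
sentences, never asserted; the uniqueness clause of Thm 2 («exactly one») is not needed for Prop. 2 as typed and is not used; GAPS G-B11-A4
(U₀ ∈ 𝔘_k(C₁B₃ε₁) vs α₀ = ε₀) sits inside the law `hyp133` exactly as in print.  Mega-formalization `lit-balaban`, HOME
`run/shared/lean/pub/lit-balaban/`, reader/typer seat r08 gen 7 (unit `lit-balaban-r08`).  Imports `B11` (→ `B8`); modifies nothing.
Net new unproved facts: 0 (one dictionary structure + one hypothesis structure).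
-/

namespace Literature.MathematicalPhysics.QuantumFieldTheory.Balaban1983to89.B11Prop2Assembly

open B11

variable {I : Type}

/-! ## §1 The bridge between [6]'s Theorem-2 carrier and the Sect. A–E carrier -/

/-- The dictionary for ONE geometric datum: `cfg U₀` = the background U₀ of (14) read on [6]'s carrier ((1.33)); `pert U′` = a
configuration U′ of the axial-gauge space (18) read as [6]'s perturbation ((1.34)–(1.35)); `back U₁` = a Landau-gauge configuration
U₁ = U′^{u⁻¹} of [6] read as a B11 perturbation (the U₁ of (19)–(21)); `gt u` = [6]'s gauge transformation u read on the B11 carrier.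
[cite: Balaban1985Variational, (14)–(18) p.280, (19)–(21) p.281] -/
structure Bridge62 (G : B8.GFData) (D : LGData) where
  cfg : D.Cfg → G.Cfg
  pert : D.Pert → G.Pert
  back : G.Pert → D.Pert
  gt : G.GT → D.GT

/-- The located sentences of pp. 280–281 as laws of the bridge, for backgrounds U₀ with (14) at constants C₁, B₃ (hypotheses, never
asserted): `hyp133` = *"Configurations U from the space (18), and U₀, satisfy the assumptions (1.33)–(1.35) of this theorem with α₀ = ε₀,
α₁ = C₁ε₁. The additional regularity condition (3.35) in (1.33) is satisfied for U₀ also, because of the result of Sect. F."*; `to19_21` =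
*"U₁ = U′^{u^{−1}} satisfies the conditions (1.36)–(1.39) of [6]. These gauge transformations define a mapping of the space (18) into a space
of gauge field configurations U₁U₀ with U₁ satisfying the conditions (19)–(21) … with ε₂ ≧ B₁(ε₀ + C₁ε₁)"* (for whichever constants B₁, B₂
the conditions (1.36)–(1.39) carry); `restricted` = the conditions \overline{R₀u}^j = 1 are the same on both carriers; `axial_back` = (16):
transforming U₁ = U′^{u⁻¹} by u gives back U′ («transforming them to the axial gauge Ax_k(𝔅_k, U₀) by gauge transformations u»); `crit` =
*"using again the gauge invariance of the functional (5)"*: a critical U′U₀ of (5) in (18) gives a critical U₁ of A(U₁U₀) in (19)–(21).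
[cite: Balaban1985Variational, pp.280–281 before Prop. 2; (16) p.280] -/
structure Bridge62.Laws {G : B8.GFData} {D : LGData} (β : Bridge62 G D) (C₁ B₃ : ℝ) : Prop where
  hyp133 : ∀ (ε₀ ε₁ : ℝ) (V : D.Bdry) (U₀ : D.Cfg) (U' : D.Pert),
    D.Sat14 (C₁ * B₃ * ε₁) (C₁ * ε₁) V U₀ → D.In18 ε₀ V U₀ U' →
      G.InA ε₀ (β.cfg U₀) ∧ G.Reg335 ε₀ (β.cfg U₀) ∧ G.InAAx ε₀ (β.cfg U₀) (β.pert U') ∧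
        G.avgClose (C₁ * ε₁) (β.cfg U₀) (β.pert U')
  to19_21 : ∀ (B₁ B₂ ε₀ ε₁ ε₂ : ℝ) (V : D.Bdry) (U₀ : D.Cfg) (U' : D.Pert) (u : G.GT),
    D.Sat14 (C₁ * B₃ * ε₁) (C₁ * ε₁) V U₀ → D.In18 ε₀ V U₀ U' → G.Restricted (β.cfg U₀) u →
      G.C136 B₁ B₂ (ε₀ + C₁ * ε₁) (β.cfg U₀) (G.act (β.pert U') u) → G.C137 (C₁ * ε₁) (β.cfg U₀) (G.act (β.pert U') u) →
      G.Landau (β.cfg U₀) (G.act (β.pert U') u) → G.C139 B₁ (ε₀ + C₁ * ε₁) (β.cfg U₀) (G.act (β.pert U') u) →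
      B₁ * (ε₀ + C₁ * ε₁) ≤ ε₂ → D.In19_21 ε₂ V U₀ (β.back (G.act (β.pert U') u))
  restricted : ∀ (U₀ : D.Cfg) (u : G.GT), G.Restricted (β.cfg U₀) u → D.Restricted U₀ (β.gt u)
  axial_back : ∀ (U₀ : D.Cfg) (U' : D.Pert) (u : G.GT), G.Restricted (β.cfg U₀) u →
    D.toAxial U₀ (β.back (G.act (β.pert U') u)) (β.gt u) = U'
  crit : ∀ (ε₀ ε₂ : ℝ) (V : D.Bdry) (U₀ : D.Cfg) (U' : D.Pert) (u : G.GT),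
    D.In18 ε₀ V U₀ U' → D.Crit V U₀ U' → G.Restricted (β.cfg U₀) u →
      D.In19_21 ε₂ V U₀ (β.back (G.act (β.pert U') u)) → D.CritL V U₀ (β.back (G.act (β.pert U') u))

/-! ## §2 Proposition 2 from Theorem 2 of [6] -/

/-- **Proposition 2 at given Theorem-2 constants**: if the body of [6] Thm 2 holds with constants B₁, B₂, c₁ (the existence half: for
α₀ + α₁ ≤ c₁ a restricted u with U′^{u⁻¹} satisfying (1.36)–(1.39)), then for every bridged family with the laws of §1 and C₁ > 0, the typed
statement of record `B11.Prop2Printed B₁ B₃ C₁ c₁ famD` holds. [cite: Balaban1985Variational, Prop. 2 p.281; pp.280–281] -/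
theorem prop2Printed_of_thm2_at {famG : I → B8.GFData} {famD : I → LGData} (β : ∀ i, Bridge62 (famG i) (famD i))
    {B₁ B₂ c₁ C₁ B₃ : ℝ} (laws : ∀ i, (β i).Laws C₁ B₃) (hC₁ : 0 < C₁)
    (H : ∀ i : I, ∀ α₀ α₁ : ℝ, 0 < α₀ → 0 < α₁ → α₀ + α₁ ≤ c₁ →
      ∀ U₀ : (famG i).Cfg, ∀ U' : (famG i).Pert,
        (famG i).InA α₀ U₀ → (famG i).Reg335 α₀ U₀ → (famG i).InAAx α₀ U₀ U' → (famG i).avgClose α₁ U₀ U' →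
          ∃ u : (famG i).GT, (famG i).Restricted U₀ u ∧
            ((famG i).C136 B₁ B₂ (α₀ + α₁) U₀ ((famG i).act U' u) ∧ (famG i).C137 α₁ U₀ ((famG i).act U' u) ∧
              (famG i).Landau U₀ ((famG i).act U' u) ∧ (famG i).C139 B₁ (α₀ + α₁) U₀ ((famG i).act U' u))) :
    Prop2Printed B₁ B₃ C₁ c₁ famD := by
  intro i ε₀ ε₁ ε₂ hε₀ hε₁ hsum hε₂ V U₀ h14 U' h18 hcrit
  obtain ⟨hA, hreg, hAx, hcl⟩ := (laws i).hyp133 ε₀ ε₁ V U₀ U' h14 h18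
  obtain ⟨u, hu, h136, h137, hL, h139⟩ :=
    H i ε₀ (C₁ * ε₁) hε₀ (mul_pos hC₁ hε₁) hsum ((β i).cfg U₀) ((β i).pert U') hA hreg hAx hcl
  refine ⟨(β i).gt u, (β i).back ((famG i).act ((β i).pert U') u), (laws i).restricted U₀ u hu, ?_, ?_,
    (laws i).axial_back U₀ U' u hu⟩
  · exact (laws i).to19_21 B₁ B₂ ε₀ ε₁ ε₂ V U₀ U' u h14 h18 hu h136 h137 hL h139 hε₂
  · exact (laws i).crit ε₀ ε₂ V U₀ U' u h18 hcrit hu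
      ((laws i).to19_21 B₁ B₂ ε₀ ε₁ ε₂ V U₀ U' u h14 h18 hu h136 h137 hL h139 hε₂)

/-- **Proposition 2 ASSEMBLED from [6] Theorem 2 BY NAME**: `B8.Thm2Printed famG` (typed statement of record of [Balaban1985RegularSpaces]
Thm 2, row B8.Thm2) ⇒ for every bridged family with the laws of §1 (C₁ > 0) there are [6]'s constants B₁, c₁ > 0 with
`B11.Prop2Printed B₁ B₃ C₁ c₁ famD`. [cite: Balaban1985Variational, Prop. 2 p.281; pp.280–281] -/
theorem prop2Printed_of_thm2 {famG : I → B8.GFData} {famD : I → LGData} (β : ∀ i, Bridge62 (famG i) (famD i))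
    {C₁ B₃ : ℝ} (laws : ∀ i, (β i).Laws C₁ B₃) (hC₁ : 0 < C₁) (h2 : B8.Thm2Printed famG) :
    ∃ B₁ c₁ : ℝ, 0 < B₁ ∧ 0 < c₁ ∧ Prop2Printed B₁ B₃ C₁ c₁ famD := by
  obtain ⟨B₁, B₂, c₁, hB₁, _, hc₁, H⟩ := h2
  refine ⟨B₁, c₁, hB₁, hc₁, prop2Printed_of_thm2_at β (B₂ := B₂) laws hC₁ fun i α₀ α₁ h0 h1 hs U₀ U' hA hreg hAx hcl => ?_⟩
  obtain ⟨u, hu, hconds, _⟩ := H i α₀ α₁ h0 h1 hs U₀ U' hA hreg hAx hcl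
  exact ⟨u, hu, hconds⟩

/-- The same through the tree's located edge `B11.p280_landau_gauge_of_B8Thm2` form of the input: [6] Thm 2 WITHOUT the (3.35) clause in
its hypotheses plus the implication 𝔄_k(α₀) ⊂ Reg335(α₀) (= [6] Sect. F, Prop. 6) gives Proposition 2 as well — the bridge law `hyp133`
already supplies (3.35) («because of the result of Sect. F»), so this is the same statement; recorded for consumers holding `hreg`.
[cite: Balaban1985Variational, p.280 «The additional regularity condition (3.35) … because of the result of Sect. F»] -/
theorem prop2Printed_of_thm2_hreg {famG : I → B8.GFData} {famD : I → LGData} (β : ∀ i, Bridge62 (famG i) (famD i))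
    {C₁ B₃ : ℝ} (laws : ∀ i, (β i).Laws C₁ B₃) (hC₁ : 0 < C₁) (h2 : B8.Thm2Printed famG)
    (hreg : ∀ i α₀ (U₀ : (famG i).Cfg), (famG i).InA α₀ U₀ → (famG i).Reg335 α₀ U₀) :
    ∃ B₁ c₁ : ℝ, 0 < B₁ ∧ 0 < c₁ ∧ Prop2Printed B₁ B₃ C₁ c₁ famD := by
  obtain ⟨B₁, B₂, c₁, hB₁, _, hc₁, H⟩ := p280_landau_gauge_of_B8Thm2 famG h2 hreg C₁ hC₁
  refine ⟨B₁, c₁, hB₁, hc₁, prop2Printed_of_thm2_at β (B₂ := B₂) laws hC₁ fun i α₀ α₁ h0 h1 hs U₀ U' hA _ hAx hcl => ?_⟩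
  -- `p280_landau_gauge_of_B8Thm2` is stated at α₁ = C₁ε₁; rescale ε₁ := α₁/C₁
  have hε : C₁ * (α₁ / C₁) = α₁ := by field_simp
  obtain ⟨u, hu, hconds, _⟩ := H i α₀ (α₁ / C₁) h0 (div_pos h1 hC₁) (by rw [hε]; exact hs) U₀ U' hA hAx (by rw [hε]; exact hcl)
  rw [hε] at hconds
  exact ⟨u, hu, hconds⟩

end Literature.MathematicalPhysics.QuantumFieldTheory.Balaban1983to89.B11Prop2Assembly
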